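import Summits.QuantumFields.BalabanUV.Beta.GAN24.DerivativeRateTransferKKTSources
import Literature.MathematicalPhysics.QuantumFieldTheory.GaussianToolkit

/-!
# `BalabanUV.Beta.GAN24.DerivativeRateTransferKKTSourcesFluc` — binder row G-an2-4 ∕ (CONV-C), route R6 «VALUES, NOT DERIVATIVES», PART 44:
# THE LOEWNER SANDWICH FOR THE TWO-GRID COVARIANCE DIFFERENCE, «(FLUC-OP) ⟸ (F1) + (F2)», and THE DIRECT ROAD «(CONS♭) ⟸ (F1′) + (SRC-f) + (VAL₁)» —
# `‖𝒢_Λ f‖²_{D₀} ≤ ⟨f,(𝒢_H − 𝒢_Λ)f⟩ ≤ ‖𝒢_H f‖²_{D₀}` (`D₀ = Λ − H`), `H·𝒢_H = 1 − Qᵀℋᴸ_H`, so a SECOND-ORDER consistency row (F1) `D₀ ≤ c₁·H·H` (forms) and a projector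
# row (F2) `‖(1 − Qᵀℋᴸ_H)f‖² ≤ C_P‖f‖²` give (FLUC-OP) with `C_G = c₁·C_P`; and the differentiated Euler–Lagrange equation `Λ·dℋ = f₁ + Qᵀ·d𝒮` with (F1′)
# `D₀ ≤ c₁′·Λ·Λ` gives (CONS♭) from the fine source and the VALUE jet alone; plus the scalar core of (F2) on one fibre (unit b2b-balaban-gan24-p3, gen 40; v1.2 = v1 + §4 + the RESULT∕scratch credit line)

NOT IN PRINT; OUR PROOF (for the ROUTE; [folklore] finite-dimensional linear algebra — PART 42 `DerivativeRateTransferKKTSources.{kktPoint_sub, kktPoint_stationarity,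
constrained_energy_le_pairing_sub, pairing_sub_expand, dotProduct_mulVec_symm}`, an2's `Beta.CompositionSingular.{kkt_mul_blocks, minOpL_eq_transpose}`, an1's
`Beta.BorderedJets.{dMinOp_eq, dEffForm_eq}`,
`GaussianToolkit.dotProduct_mulVec_sq_le` (PSD Cauchy–Schwarz) and PART 18 `transpose_eq_of_posSemidef` BY NAME).  CREDIT: the sandwich, the discharge line
«(FLUC-OP) ⟸ (F1) + (F2)» and the direct road «(CONS♭) ⟸ (F1′) + (SRC-f) + (VAL₁)» are gan24-idea-1 g50's LENS ITEM 7 «LOEWNER SANDWICH FOR THE CONSISTENCY DEFECT»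
([IDEA1-G50-ONLINE] l.45169; W-idea1-g50-1 l.45403 (i)∕(ii): «whether (F1′) is worth a bordered-letter corollary beside §5 is the holder's call» — taken; RESULT [IDEA1-G50-RESULT] l.45556, ROUTES-GAN24 v50 R6 NOTE; scratch `records-g50/sketch/LoewnerSandwichSketch.lean` 52abad271152b756 = `GAN24Scratch.LoewnerSandwich.{flucOp_le, consFlat_le, fibre_weight_ineq}` in abstract inner-product letters, rc 0, NOT proposed under FREEZE (0)): (F1) the
one-step second-order two-grid consistency of the effective form as a SYMBOL inequality `0 ≤ D_{j,0} ≤ c₁(L,d)·A_j²`, (F2) the norm of the oblique projector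
`P_j = 1 − A_jG_{H_j}`, (F1′) the same consistency in the `Λ`-metric; this file types the operator-algebra implications in the route's bordered letters, with (F1),
(F1′), (F2) DISPLAYED as hypotheses in form currency (nothing of them is supplied).
HONEST FRAMING (cell contract, verbatim): «discharging `BetaPertH` makes Bałaban's UV stability UNCONDITIONAL — a real constructive-QFT result; it is NOT the continuum limit
and NOT the Clay problem.»  HONEST DEPENDENCY (verbatim): «continuum YM on T⁴ ⇐ BetaPertH ∧ nine spine estimates (0/9 proved); BetaPertH ⇐ (D1) ∧ (D4) ∧ CAP+tail;
G-an2-4 gates asym, D1 and NE2/3/4.»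

WHAT THIS FILE PROVES (0 sorry, 0 `def`, nothing cited; `ℝ`, symmetric data, both bordered matrices nonsingular):
* §1 `form_flucCov_sub_eq_cross` (`⟨f,(𝒢_H − 𝒢_Λ)f⟩ = ⟨𝒢_Λ f, (Λ − H)𝒢_H f⟩` — (R) mirrored at a pure fine source), **`flucCov_energy_le_form_sub`**
  (`H ⪰ 0 ⟹ ‖𝒢_Λ f‖²_{Λ−H} ≤ ⟨f,(𝒢_H − 𝒢_Λ)f⟩`, PART 42's squeeze at `e = 0`), **`form_flucCov_sub_le_flucCov_energy`** (`H ⪰ 0`, `Λ − H ⪰ 0` ⟹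
  `⟨f,(𝒢_H − 𝒢_Λ)f⟩ ≤ ‖𝒢_H f‖²_{Λ−H}` — Cauchy–Schwarz in the `(Λ − H)`-seminorm), i.e. THE SANDWICH `‖𝒢_Λ f‖²_{D₀} ≤ ⟨f,(𝒢_H − 𝒢_Λ)f⟩ ≤ ‖𝒢_H f‖²_{D₀}`.
* §2 `mulVec_flucCov_eq` (`H(𝒢_H f) = f − Qᵀ(ℋᴸ_H f)`, an2's `H𝒢 + Qᵀℋᴸ = 1`), **`flucOp_of_consistency_of_projector`** — «(FLUC-OP) ⟸ (F1) + (F2)»: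
  (F1) `⟨w,(Λ − H)w⟩ ≤ c₁·⟨Hw, Hw⟩` for all `w`, (F2) `⟨f − Qᵀℋᴸ_H f, f − Qᵀℋᴸ_H f⟩ ≤ C_P·⟨f,f⟩` for all `f`, `0 ≤ c₁` ⟹ `⟨f,(𝒢_H − 𝒢_Λ)f⟩ ≤ c₁·C_P·⟨f,f⟩`
  for all `f` (the (FLUC-OP) hypothesis of PARTs 42 ∕ 43 with `C_G = c₁·C_P`; gan24-idea-1 g50 W-1 (i): toy `c₁(L) = (L²−1)∕(2(L²+2))`, `‖P‖ ≤ (π∕2)^d`).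
* §3 THE DIRECT ROAD (gan24-idea-1 g50 W-1 (ii), «the holder's call» — taken): (any field) **`mul_dMinOp_eq`** (the differentiated Euler–Lagrange equation
  `K·dℋ(K,Q;K₁,Q₁) = (Q₁ᵀ𝒮_K − K₁ℋ_K) + Qᵀ·d𝒮(K,Q;K₁,Q₁)` — fine source plus the transposed constraint on the VALUE jet); (`ℝ`) **`constrained_energy_le_of_sqConsistency`**
  ((F1′) `⟨v,(Λ − K)v⟩ ≤ c₁′⟨Λv,Λv⟩` + PART 42's stationarity ⟹ `⟨φ_Λ,(Λ − K)φ_Λ⟩ ≤ c₁′‖f − Qᵀ(ℋᴸ_Λ f − 𝒮_Λ e)‖²` — no fluctuation covariance, no value row, no `c_D`),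
  **`jet_constrained_energy_le_of_sqConsistency`** (`⟨dℋe,(Λ − K)dℋe⟩ ≤ 2c₁′(⟨f₁e,f₁e⟩ + ⟨Qᵀd𝒮e,Qᵀd𝒮e⟩)`), and the tower END **`jetRange_cons_rate_of_sqConsistency`**:
  (F1′)_j + (SRC-f) `≤ c_F θ^j` + (AVG) `⟨(Qc j)ᵀw,(Qc j)ᵀw⟩ ≤ g θ^j⟨w,w⟩` + (VAL₁) `⟨𝒮₁e,𝒮₁e⟩ ≤ V⟨e,e⟩` (`𝒮₁ = d𝒮(Λ_j,Qc_j;Λ₁ j,Q₁ j) = 𝒮_{j+1,1}`) ⟹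
  `⟨ℋ̃_{j,1}e,(Λ_j − H_j)ℋ̃_{j,1}e⟩ ≤ 2c₁′(c_F + g·V)·θ^j·⟨e,e⟩` ∀ j e (toy: `c₁′(L) = (L²−1)∕(6L²)`, `‖Qc_jᵀ‖² = l^{−d}`).
* §4 **`fibre_weight_ineq`** (gan24-idea-1 g50's scratch lemma re-typed verbatim with credit): the scalar core of (F2) on one Bloch fibre,
  `w i₀ · Σ w_i∕A_i² ≤ (Σ w_i∕A_i)²` for `A i₀` minimal, `w i₀ > 0` — `‖P‖² ≤ 1∕w i₀` for the rank-one oblique projector of the block-mean fibre.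
WHAT IT DOES NOT DO: supply (F1) ∕ (F1′) (the second-order symbol inequalities for Bałaban's ∕ King's one-step effective form — OPEN; the toy constants and the
certificate `λ_max(D₀ − c₁A_j²) ≤ 6.8e-15` of kit j168197 are gan24-idea-1's numbers, not theorems), (F2), (SRC-f), (AVG) or (VAL₁) for any true averaging;
nothing printed is asserted.  SUPPLIER work on route R6 (rank 2, REDUCTION, no seat); no consumer of record; NEVER «G-an2-4 closed»; NOT (CONV-C), NOT D1, NOT
`BetaPertH`, NOT continuum, NOT Clay.  Records: `HOME/b2b-balaban-gan24-p3/WOODBURY-FIBRE.md` v14.0.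
-/

noncomputable section

open Matrix

namespace Summit.QuantumFields.BalabanUV.Beta.GAN24.DerivativeRateTransferKKTSourcesFluc

open Literature.MathematicalPhysics.QuantumFieldTheory.Balaban1983to89.Beta.Composition (kkt)
open Literature.MathematicalPhysics.QuantumFieldTheory.Balaban1983to89.Beta.CompositionSingular (effForm minOp minOpL flucCov kkt_mul_blocks minOpL_eq_transpose)
open Literature.MathematicalPhysics.QuantumFieldTheory.GaussianToolkit (dotProduct_mulVec_sq_le)
open Summit.QuantumFields.BalabanUV.Beta.GAN24.DerivativeRateTransferLoewnerKKT (transpose_eq_of_posSemidef)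
open Literature.MathematicalPhysics.QuantumFieldTheory.Balaban1983to89.Beta.BorderedJets (dMinOp dEffForm dMinOp_eq dEffForm_eq)
open Summit.QuantumFields.BalabanUV.Beta.GAN24.DerivativeRateTransferKKTSources (kktPoint_sub constrained_energy_le_pairing_sub pairing_sub_expand
  dotProduct_mulVec_symm kktPoint_stationarity)

variable {ν μ : Type*} [Fintype ν] [Fintype μ] [DecidableEq ν] [DecidableEq μ]
variable {H Λ : Matrix ν ν ℝ} {Q : Matrix μ ν ℝ}

/-! ## §1 The Loewner sandwich for `𝒢_H − 𝒢_Λ` -/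

/-- **`form_flucCov_sub_eq_cross`** [folklore]: symmetric `H, Λ`, nonsingular bordered matrices ⟹ `⟨f,(𝒢_H − 𝒢_Λ)f⟩ = ⟨𝒢_Λ f, (Λ − H)·𝒢_H f⟩` — PART 42's
`kktPoint_sub` (`𝒢_Λ f − 𝒢_H f = −𝒢_H(Λ − H)𝒢_Λ f` at the pure fine source `(f, 0)`) paired with `f`. -/
theorem form_flucCov_sub_eq_cross (hHs : Hᵀ = H) (hΛs : Λᵀ = Λ) (hH : IsUnit (kkt H Q).det) (hΛ : IsUnit (kkt Λ Q).det) (f : ν → ℝ) :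
    f ⬝ᵥ ((flucCov H Q - flucCov Λ Q) *ᵥ f) = (flucCov Λ Q *ᵥ f) ⬝ᵥ ((Λ - H) *ᵥ (flucCov H Q *ᵥ f)) := by
  have hGt : (flucCov H Q)ᵀ = flucCov H Q := (minOpL_eq_transpose H Q hHs).2.1
  have hDt : (Λ - H)ᵀ = Λ - H := by rw [transpose_sub, hΛs, hHs]
  have hsub := kktPoint_sub hH hΛ f 0
  simp only [mulVec_zero, add_zero] at hsub
  have e1 : (flucCov H Q - flucCov Λ Q) *ᵥ f = flucCov H Q *ᵥ ((Λ - H) *ᵥ (flucCov Λ Q *ᵥ f)) := by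
    rw [sub_mulVec, ← neg_sub, hsub, neg_neg]
  rw [e1, dotProduct_mulVec_symm hGt, dotProduct_mulVec_symm hDt, dotProduct_comm]

/-- **`flucCov_energy_le_form_sub` — THE SANDWICH, LOWER HALF** [folklore; gan24-idea-1 g50 lens item 7]: `H ⪰ 0`, `Λ` symmetric ⟹
`⟨𝒢_Λ f, (Λ − H)𝒢_Λ f⟩ ≤ ⟨f,(𝒢_H − 𝒢_Λ)f⟩` (PART 42's squeeze at the pure fine source; gan24-p4's `flucCov_coarsen_antitone` is its sign). -/
theorem flucCov_energy_le_form_sub (hHp : H.PosSemidef) (hΛs : Λᵀ = Λ) (hH : IsUnit (kkt H Q).det) (hΛ : IsUnit (kkt Λ Q).det) (f : ν → ℝ) :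
    (flucCov Λ Q *ᵥ f) ⬝ᵥ ((Λ - H) *ᵥ (flucCov Λ Q *ᵥ f)) ≤ f ⬝ᵥ ((flucCov H Q - flucCov Λ Q) *ᵥ f) := by
  have h := constrained_energy_le_pairing_sub hHp hΛs hH hΛ f 0
  rw [pairing_sub_expand (transpose_eq_of_posSemidef hHp) hΛs] at h
  simpa only [mulVec_zero, add_zero, dotProduct_zero, mul_zero, zero_dotProduct, sub_zero] using h

/-- **`form_flucCov_sub_le_flucCov_energy` — THE SANDWICH, UPPER HALF** [our proof; gan24-idea-1 g50 lens item 7 «`⟨f,(G_H − G_Λ)f⟩ ≤ ‖G_H f‖²_{D₀}`»]: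
`H ⪰ 0`, `Λ − H ⪰ 0`, nonsingular bordered matrices ⟹ `⟨f,(𝒢_H − 𝒢_Λ)f⟩ ≤ ⟨𝒢_H f, (Λ − H)𝒢_H f⟩` (cross form + Cauchy–Schwarz in the `(Λ − H)`-seminorm +
the lower half). -/
theorem form_flucCov_sub_le_flucCov_energy (hHp : H.PosSemidef) (hΛs : Λᵀ = Λ) (hD : (Λ - H).PosSemidef) (hH : IsUnit (kkt H Q).det)
    (hΛ : IsUnit (kkt Λ Q).det) (f : ν → ℝ) :
    f ⬝ᵥ ((flucCov H Q - flucCov Λ Q) *ᵥ f) ≤ (flucCov H Q *ᵥ f) ⬝ᵥ ((Λ - H) *ᵥ (flucCov H Q *ᵥ f)) := by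
  set a : ν → ℝ := flucCov Λ Q *ᵥ f
  set b : ν → ℝ := flucCov H Q *ᵥ f
  set X : ℝ := f ⬝ᵥ ((flucCov H Q - flucCov Λ Q) *ᵥ f) with hX
  have hcross : X = a ⬝ᵥ ((Λ - H) *ᵥ b) := form_flucCov_sub_eq_cross (transpose_eq_of_posSemidef hHp) hΛs hH hΛ f
  have hlow : a ⬝ᵥ ((Λ - H) *ᵥ a) ≤ X := flucCov_energy_le_form_sub hHp hΛs hH hΛ f
  have hDt : (Λ - H)ᵀ = Λ - H := transpose_eq_of_posSemidef hD
  have hnn : ∀ v : ν → ℝ, 0 ≤ v ⬝ᵥ (Λ - H) *ᵥ v := fun v => by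
    have := hD.dotProduct_mulVec_nonneg v; rwa [star_trivial] at this
  have hcs := dotProduct_mulVec_sq_le hDt hnn a b
  have hb : 0 ≤ b ⬝ᵥ ((Λ - H) *ᵥ b) := hnn b
  have ha : 0 ≤ a ⬝ᵥ ((Λ - H) *ᵥ a) := hnn a
  -- `X² = ⟨a,D₀b⟩² ≤ ⟨a,D₀a⟩⟨b,D₀b⟩ ≤ X·⟨b,D₀b⟩`, hence `X ≤ ⟨b,D₀b⟩` (if `X ≤ 0` it is below the nonnegative right side anyway)
  by_cases hX0 : X ≤ 0
  · exact hX0.trans hb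
  · have hXpos : 0 < X := lt_of_not_ge hX0
    have h2 : X ^ 2 ≤ X * (b ⬝ᵥ ((Λ - H) *ᵥ b)) := by
      calc X ^ 2 = (a ⬝ᵥ ((Λ - H) *ᵥ b)) ^ 2 := by rw [hcross]
        _ ≤ (a ⬝ᵥ ((Λ - H) *ᵥ a)) * (b ⬝ᵥ ((Λ - H) *ᵥ b)) := hcs
        _ ≤ X * (b ⬝ᵥ ((Λ - H) *ᵥ b)) := mul_le_mul_of_nonneg_right hlow hb
    nlinarith

/-! ## §2 «(FLUC-OP) ⟸ (F1) + (F2)» -/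

/-- [folklore] `H(𝒢_H f) = f − Qᵀ(ℋᴸ_H f)` (an2's `H𝒢 + Qᵀℋᴸ = 1` at one vector): `H𝒢_H = 1 − P` with the oblique projector `P := Qᵀℋᴸ_H`. -/
theorem mulVec_flucCov_eq (h : IsUnit (kkt H Q).det) (f : ν → ℝ) : H *ᵥ (flucCov H Q *ᵥ f) = f - Qᵀ *ᵥ (minOpL H Q *ᵥ f) := by
  have h1 : H * flucCov H Q + Qᵀ * minOpL H Q = 1 := (kkt_mul_blocks H Q h).1
  rw [eq_sub_iff_add_eq, mulVec_mulVec, mulVec_mulVec, ← add_mulVec, h1, one_mulVec]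

/-- **`flucOp_of_consistency_of_projector` — «(FLUC-OP) ⟸ (F1) + (F2)»** [our proof; gan24-idea-1 g50 LENS ITEM 7's operator-algebra implication in bordered
letters]: `H ⪰ 0`, `Λ − H ⪰ 0`, nonsingular bordered matrices, (F1) the second-order consistency row `⟨w,(Λ − H)w⟩ ≤ c₁·⟨Hw,Hw⟩` (`c₁ ≥ 0`), (F2) the projector row
`⟨f − Qᵀℋᴸ_H f, f − Qᵀℋᴸ_H f⟩ ≤ C_P·⟨f,f⟩` ⟹ `⟨f,(𝒢_H − 𝒢_Λ)f⟩ ≤ c₁·C_P·⟨f,f⟩` — the (FLUC-OP) row of PARTs 42 ∕ 43 with `C_G = c₁·C_P`. -/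
theorem flucOp_of_consistency_of_projector (hHp : H.PosSemidef) (hΛs : Λᵀ = Λ) (hD : (Λ - H).PosSemidef) (hH : IsUnit (kkt H Q).det)
    (hΛ : IsUnit (kkt Λ Q).det) {c₁ CP : ℝ} (hc₁ : 0 ≤ c₁) (hF1 : ∀ w : ν → ℝ, w ⬝ᵥ ((Λ - H) *ᵥ w) ≤ c₁ * ((H *ᵥ w) ⬝ᵥ (H *ᵥ w)))
    (hF2 : ∀ f : ν → ℝ, (f - Qᵀ *ᵥ (minOpL H Q *ᵥ f)) ⬝ᵥ (f - Qᵀ *ᵥ (minOpL H Q *ᵥ f)) ≤ CP * (f ⬝ᵥ f)) (f : ν → ℝ) :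
    f ⬝ᵥ ((flucCov H Q - flucCov Λ Q) *ᵥ f) ≤ c₁ * CP * (f ⬝ᵥ f) := by
  refine (form_flucCov_sub_le_flucCov_energy hHp hΛs hD hH hΛ f).trans ?_
  refine (hF1 (flucCov H Q *ᵥ f)).trans ?_
  rw [mulVec_flucCov_eq hH, mul_assoc]
  exact mul_le_mul_of_nonneg_left (hF2 f) hc₁

/-! ## §3 The direct road: (F1′) `Λ − H ≤ c₁′·Λ·Λ` + stationarity — (CONS♭) from (SRC-f) and the value JET only (gan24-idea-1 g50 W-1 (ii)) -/

section Direct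

variable {𝕜 : Type*} [Field 𝕜]
variable {ν' μ' : Type*} [Fintype ν'] [Fintype μ'] [DecidableEq ν'] [DecidableEq μ']

/-- **`mul_dMinOp_eq` — THE DIFFERENTIATED EULER–LAGRANGE EQUATION** [folklore; an1's `dMinOp_eq ∕ dEffForm_eq` + an2's block identities]: `K·dℋ(K,Q;K₁,Q₁) =
(Q₁ᵀ𝒮_K − K₁ℋ_K) + Qᵀ·d𝒮(K,Q;K₁,Q₁)` — differentiate `Kℋ = Qᵀ𝒮`: the fine source `f₁` plus the transposed constraint applied to the VALUE jet (gan24-idea-1 g50's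
«`Λ_jℋ̃_{j,1} = f_{j,1} + Qc_jᵀ𝒮_{j+1,1}`»). -/
theorem mul_dMinOp_eq (K K₁ : Matrix ν' ν' 𝕜) (Q Q₁ : Matrix μ' ν' 𝕜) (h : IsUnit (kkt K Q).det) :
    K * dMinOp K Q K₁ Q₁ = (Q₁ᵀ * effForm K Q - K₁ * minOp K Q) + Qᵀ * dEffForm K Q K₁ Q₁ := by
  obtain ⟨h11, h12, -, -⟩ := kkt_mul_blocks K Q h
  -- `K𝒢 = 1 − Qᵀℋᴸ`, `Kℋ = Qᵀ𝒮`
  have hG : K * flucCov K Q = 1 - Qᵀ * minOpL K Q := eq_sub_of_add_eq h11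
  rw [dMinOp_eq, dEffForm_eq]
  have e1 : K * (flucCov K Q * K₁ * minOp K Q) = K₁ * minOp K Q - Qᵀ * (minOpL K Q * K₁ * minOp K Q) := by
    rw [← Matrix.mul_assoc, ← Matrix.mul_assoc, hG, Matrix.sub_mul, Matrix.sub_mul, Matrix.one_mul, Matrix.mul_assoc Qᵀ, Matrix.mul_assoc Qᵀ]
  have e2 : K * (minOp K Q * Q₁ * minOp K Q) = Qᵀ * (effForm K Q * Q₁ * minOp K Q) := by
    rw [← Matrix.mul_assoc, ← Matrix.mul_assoc, h12, Matrix.mul_assoc Qᵀ, Matrix.mul_assoc Qᵀ]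
  have e3 : K * (flucCov K Q * Q₁ᵀ * effForm K Q) = Q₁ᵀ * effForm K Q - Qᵀ * (minOpL K Q * Q₁ᵀ * effForm K Q) := by
    rw [← Matrix.mul_assoc, ← Matrix.mul_assoc, hG, Matrix.sub_mul, Matrix.sub_mul, Matrix.one_mul, Matrix.mul_assoc Qᵀ, Matrix.mul_assoc Qᵀ]
  rw [Matrix.mul_add, Matrix.mul_sub, Matrix.mul_neg, e1, e2, e3, Matrix.mul_sub, Matrix.mul_sub]
  abel

end Direct

section DirectReal

variable {ν' μ' : Type*} [Fintype ν'] [Fintype μ'] [DecidableEq ν'] [DecidableEq μ']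
variable {K Λ' : Matrix ν' ν' ℝ} {Q' : Matrix μ' ν' ℝ}

/-- **`constrained_energy_le_of_sqConsistency` — THE DIRECT ONE-LEVEL ROAD** [our proof; gan24-idea-1 g50 W-1 (ii)]: a second-order consistency row in the `Λ`-metric,
(F1′) `⟨v,(Λ − K)v⟩ ≤ c₁′·⟨Λv,Λv⟩` for all `v`, and the stationarity of the `Λ`-KKT point `Λφ_Λ = f − Qᵀ(ℋᴸ_Λ f − 𝒮_Λ e)` (PART 42 `kktPoint_stationarity`) give
`⟨φ_Λ,(Λ − K)φ_Λ⟩ ≤ c₁′·‖f − Qᵀ(ℋᴸ_Λ f − 𝒮_Λ e)‖²` — no fluctuation covariance, no value row, no `c_D`. -/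
theorem constrained_energy_le_of_sqConsistency (hΛ : IsUnit (kkt Λ' Q').det) {c₁ : ℝ}
    (hF1 : ∀ v : ν' → ℝ, v ⬝ᵥ ((Λ' - K) *ᵥ v) ≤ c₁ * ((Λ' *ᵥ v) ⬝ᵥ (Λ' *ᵥ v))) (f : ν' → ℝ) (e : μ' → ℝ) :
    (flucCov Λ' Q' *ᵥ f + minOp Λ' Q' *ᵥ e) ⬝ᵥ ((Λ' - K) *ᵥ (flucCov Λ' Q' *ᵥ f + minOp Λ' Q' *ᵥ e)) ≤
      c₁ * ((f - Q'ᵀ *ᵥ (minOpL Λ' Q' *ᵥ f - effForm Λ' Q' *ᵥ e)) ⬝ᵥ (f - Q'ᵀ *ᵥ (minOpL Λ' Q' *ᵥ f - effForm Λ' Q' *ᵥ e))) := by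
  have hst : Λ' *ᵥ (flucCov Λ' Q' *ᵥ f + minOp Λ' Q' *ᵥ e) = f - Q'ᵀ *ᵥ (minOpL Λ' Q' *ᵥ f - effForm Λ' Q' *ᵥ e) :=
    eq_sub_of_add_eq (kktPoint_stationarity Λ' Q' hΛ f e)
  rw [← hst]
  exact hF1 _

/-- **`jet_constrained_energy_le_of_sqConsistency` — (CONS♭) AT ONE LEVEL BY THE DIRECT ROAD** [our proof; gan24-idea-1 g50 W-1 (ii)]: (F1′) + the differentiated
Euler–Lagrange equation `Λ·dℋ = f₁ + Qᵀ·d𝒮` ⟹ `⟨dℋ(Λ,Q;Λ₁,Q₁)e,(Λ − K)dℋ(…)e⟩ ≤ 2c₁′·(⟨f₁e,f₁e⟩ + ⟨Qᵀd𝒮e, Qᵀd𝒮e⟩)` (`f₁ = Q₁ᵀ𝒮_Λ − Λ₁ℋ_Λ`,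
`d𝒮 = d𝒮(Λ,Q;Λ₁,Q₁)` — at the tower end the next-level VALUE jet `𝒮_{j+1,1}`), `c₁′ ≥ 0`. -/
theorem jet_constrained_energy_le_of_sqConsistency (hΛ : IsUnit (kkt Λ' Q').det) {c₁ : ℝ} (hc₁ : 0 ≤ c₁)
    (hF1 : ∀ v : ν' → ℝ, v ⬝ᵥ ((Λ' - K) *ᵥ v) ≤ c₁ * ((Λ' *ᵥ v) ⬝ᵥ (Λ' *ᵥ v))) (Λ₁ : Matrix ν' ν' ℝ) (Q₁ : Matrix μ' ν' ℝ) (e : μ' → ℝ) :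
    (dMinOp Λ' Q' Λ₁ Q₁ *ᵥ e) ⬝ᵥ ((Λ' - K) *ᵥ (dMinOp Λ' Q' Λ₁ Q₁ *ᵥ e)) ≤
      2 * c₁ * (((Q₁ᵀ * effForm Λ' Q' - Λ₁ * minOp Λ' Q') *ᵥ e) ⬝ᵥ ((Q₁ᵀ * effForm Λ' Q' - Λ₁ * minOp Λ' Q') *ᵥ e) +
        (Q'ᵀ *ᵥ (dEffForm Λ' Q' Λ₁ Q₁ *ᵥ e)) ⬝ᵥ (Q'ᵀ *ᵥ (dEffForm Λ' Q' Λ₁ Q₁ *ᵥ e))) := by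
  set a : ν' → ℝ := (Q₁ᵀ * effForm Λ' Q' - Λ₁ * minOp Λ' Q') *ᵥ e
  set b : ν' → ℝ := Q'ᵀ *ᵥ (dEffForm Λ' Q' Λ₁ Q₁ *ᵥ e)
  have hst : Λ' *ᵥ (dMinOp Λ' Q' Λ₁ Q₁ *ᵥ e) = a + b := by
    rw [mulVec_mulVec, mul_dMinOp_eq Λ' Λ₁ Q' Q₁ hΛ, add_mulVec, ← mulVec_mulVec]
  have h1 := hF1 (dMinOp Λ' Q' Λ₁ Q₁ *ᵥ e)
  rw [hst] at h1
  have hpar : (a + b) ⬝ᵥ (a + b) ≤ 2 * (a ⬝ᵥ a) + 2 * (b ⬝ᵥ b) := by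
    have h0 : 0 ≤ (a - b) ⬝ᵥ (a - b) := by
      have := Matrix.PosSemidef.one.dotProduct_mulVec_nonneg (n := ν') (R := ℝ) (a - b)
      rwa [star_trivial, one_mulVec] at this
    have hsym : b ⬝ᵥ a = a ⬝ᵥ b := dotProduct_comm b a
    simp only [add_dotProduct, dotProduct_add, sub_dotProduct, dotProduct_sub, hsym] at h0 ⊢
    linarith
  nlinarith [mul_le_mul_of_nonneg_left hpar hc₁]

end DirectReal

section DirectTower

variable {c : Type*} [Fintype c] [DecidableEq c]
variable {ι : ℕ → Type*} [∀ j, Fintype (ι j)] [∀ j, DecidableEq (ι j)]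
variable {H : ∀ j, Matrix (ι j) (ι j) ℝ} {Qf : ∀ j, Matrix (ι j) (ι (j + 1)) ℝ} {Qc : ∀ j, Matrix c (ι j) ℝ}
variable {Λ₁ : ∀ j, Matrix (ι j) (ι j) ℝ} {Q₁ : ∀ j, Matrix c (ι j) ℝ} {c₁ cF g V θ : ℝ}

/-- **`jetRange_cons_rate_of_sqConsistency` — THE DIRECT TOWER END** [our proof; gan24-idea-1 g50 W-1 (ii) «rows (SRC-f) + (VAL₁) only»]: with
`Λ_j := 𝒮(H (j+1), Qf j)` and nonsingular `kkt Λ_j (Qc j)`: (F1′)_j `⟨v,(Λ_j − H_j)v⟩ ≤ c₁′⟨Λ_j v,Λ_j v⟩` (`c₁′ ≥ 0`), (SRC-f) `⟨f_{j,1}e,f_{j,1}e⟩ ≤ c_F θ^j⟨e,e⟩`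
(`f_{j,1} = (Q₁ j)ᵀ𝒮(Λ_j,Qc_j) − Λ₁ j·ℋ(Λ_j,Qc_j)`), (AVG) `⟨(Qc j)ᵀw,(Qc j)ᵀw⟩ ≤ g θ^j⟨w,w⟩` (the transposed composite averaging loses the block volume), (VAL₁)
`⟨𝒮₁e,𝒮₁e⟩ ≤ V⟨e,e⟩` for the value jet `𝒮₁ := d𝒮(Λ_j,Qc_j;Λ₁ j,Q₁ j)` (`= 𝒮_{j+1,1}`), `0 ≤ g` ⟹ `⟨ℋ̃_{j,1}e,(Λ_j − H_j)ℋ̃_{j,1}e⟩ ≤ 2c₁′(c_F + g·V)·θ^j·⟨e,e⟩` ∀ j e —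
no (FLUC-OP), no value row, no (STAB). -/
theorem jetRange_cons_rate_of_sqConsistency (hkΛ : ∀ j, IsUnit (kkt (effForm (H (j + 1)) (Qf j)) (Qc j)).det) (hc₁ : 0 ≤ c₁) (hg : 0 ≤ g) (hθ : 0 ≤ θ)
    (hF1 : ∀ j (v : ι j → ℝ), v ⬝ᵥ ((effForm (H (j + 1)) (Qf j) - H j) *ᵥ v) ≤
      c₁ * ((effForm (H (j + 1)) (Qf j) *ᵥ v) ⬝ᵥ (effForm (H (j + 1)) (Qf j) *ᵥ v)))
    (hF : ∀ j (e : c → ℝ),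
      (((Q₁ j)ᵀ * effForm (effForm (H (j + 1)) (Qf j)) (Qc j) - Λ₁ j * minOp (effForm (H (j + 1)) (Qf j)) (Qc j)) *ᵥ e) ⬝ᵥ
          (((Q₁ j)ᵀ * effForm (effForm (H (j + 1)) (Qf j)) (Qc j) - Λ₁ j * minOp (effForm (H (j + 1)) (Qf j)) (Qc j)) *ᵥ e) ≤ cF * θ ^ j * (e ⬝ᵥ e))
    (hQt : ∀ j (w : c → ℝ), ((Qc j)ᵀ *ᵥ w) ⬝ᵥ ((Qc j)ᵀ *ᵥ w) ≤ g * θ ^ j * (w ⬝ᵥ w))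
    (hV : ∀ j (e : c → ℝ), (dEffForm (effForm (H (j + 1)) (Qf j)) (Qc j) (Λ₁ j) (Q₁ j) *ᵥ e) ⬝ᵥ
      (dEffForm (effForm (H (j + 1)) (Qf j)) (Qc j) (Λ₁ j) (Q₁ j) *ᵥ e) ≤ V * (e ⬝ᵥ e)) :
    ∀ j (e : c → ℝ), (dMinOp (effForm (H (j + 1)) (Qf j)) (Qc j) (Λ₁ j) (Q₁ j) *ᵥ e) ⬝ᵥ
        ((effForm (H (j + 1)) (Qf j) - H j) *ᵥ (dMinOp (effForm (H (j + 1)) (Qf j)) (Qc j) (Λ₁ j) (Q₁ j) *ᵥ e)) ≤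
      2 * c₁ * (cF + g * V) * θ ^ j * (e ⬝ᵥ e) := fun j e => by
  have key := jet_constrained_energy_le_of_sqConsistency (K := H j) (hkΛ j) hc₁ (hF1 j) (Λ₁ j) (Q₁ j) e
  have h2 := hQt j (dEffForm (effForm (H (j + 1)) (Qf j)) (Qc j) (Λ₁ j) (Q₁ j) *ᵥ e)
  have h3 := hV j e
  have hθj : 0 ≤ θ ^ j := pow_nonneg hθ j
  calc _ ≤ 2 * c₁ * (cF * θ ^ j * (e ⬝ᵥ e) + g * θ ^ j * (V * (e ⬝ᵥ e))) := by
        refine key.trans ?_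
        have hb : ((Qc j)ᵀ *ᵥ (dEffForm (effForm (H (j + 1)) (Qf j)) (Qc j) (Λ₁ j) (Q₁ j) *ᵥ e)) ⬝ᵥ
            ((Qc j)ᵀ *ᵥ (dEffForm (effForm (H (j + 1)) (Qf j)) (Qc j) (Λ₁ j) (Q₁ j) *ᵥ e)) ≤ g * θ ^ j * (V * (e ⬝ᵥ e)) :=
          h2.trans (mul_le_mul_of_nonneg_left h3 (mul_nonneg hg hθj))
        nlinarith [hF j e, hb]
    _ = 2 * c₁ * (cF + g * V) * θ ^ j * (e ⬝ᵥ e) := by ring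

end DirectTower

/-! ## §4 The scalar core of (F2) on one Bloch fibre (gan24-idea-1 g50's `fibre_weight_ineq`, re-typed verbatim with credit) -/

section Fibre

/-- **`fibre_weight_ineq` — THE SCALAR CORE OF (F2) ON ONE FIBRE** [folklore; gan24-idea-1 g50's scratch `GAN24Scratch.LoewnerSandwich.fibre_weight_ineq`
(`LoewnerSandwichSketch.lean` 52abad271152b756, kernel-checked there, NOT proposed under FREEZE (0)) re-typed verbatim with credit]: for weights `w ≥ 0` on `s`, positive
alias energies `A` with `A i₀` minimal on `s` and `w i₀ > 0`: `w i₀ · Σ_{i∈s} w_i∕A_i² ≤ (Σ_{i∈s} w_i∕A_i)²` — i.e. for the rank-one oblique projector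
`P = u(A⁻¹u)ᵀ∕⟨u,A⁻¹u⟩` (`u = √w`) of the block-mean fibre, `‖P‖² = (Σ w∕A²)∕(Σ w∕A)² ≤ 1∕w i₀` (the Jordan floor on the zero-alias weight then gives
`‖P‖ ≤ (π∕2)^d`, lens item 7 (F2)). -/
theorem fibre_weight_ineq {ι : Type*} (s : Finset ι) (w A : ι → ℝ) {i₀ : ι} (hi₀ : i₀ ∈ s)
    (hw : ∀ i ∈ s, 0 ≤ w i) (hA : ∀ i ∈ s, 0 < A i) (hmin : ∀ i ∈ s, A i₀ ≤ A i) (hw₀ : 0 < w i₀) :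
    w i₀ * ∑ i ∈ s, w i / A i ^ 2 ≤ (∑ i ∈ s, w i / A i) ^ 2 := by
  have hA₀ : 0 < A i₀ := hA i₀ hi₀
  have hS₁nn : 0 ≤ ∑ i ∈ s, w i / A i := Finset.sum_nonneg (fun i hi => div_nonneg (hw i hi) (hA i hi).le)
  have step1 : ∑ i ∈ s, w i / A i ^ 2 ≤ (∑ i ∈ s, w i / A i) / A i₀ := by
    rw [Finset.sum_div]
    apply Finset.sum_le_sum
    intro i hi
    have hAi : 0 < A i := hA i hi
    have hwi : 0 ≤ w i := hw i hi
    have hprod : 0 < A i * A i₀ := mul_pos hAi hA₀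
    rw [div_div, sq]
    gcongr
    exact hmin i hi
  have step2 : w i₀ / A i₀ ≤ ∑ i ∈ s, w i / A i :=
    Finset.single_le_sum (f := fun i => w i / A i) (fun i hi => div_nonneg (hw i hi) (hA i hi).le) hi₀
  calc w i₀ * ∑ i ∈ s, w i / A i ^ 2 ≤ w i₀ * ((∑ i ∈ s, w i / A i) / A i₀) := mul_le_mul_of_nonneg_left step1 hw₀.le
    _ = (w i₀ / A i₀) * ∑ i ∈ s, w i / A i := by ring
    _ ≤ (∑ i ∈ s, w i / A i) * ∑ i ∈ s, w i / A i := mul_le_mul_of_nonneg_right step2 hS₁nn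
    _ = (∑ i ∈ s, w i / A i) ^ 2 := by ring

end Fibre

end Summit.QuantumFields.BalabanUV.Beta.GAN24.DerivativeRateTransferKKTSourcesFluc
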